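import Summits.CriticalPhenomena.PercolationContinuityZ3.Theorems.Transplant.FKConnectivityAllQForestTreeLevelTools
import Summits.CriticalPhenomena.PercolationContinuityZ3.Theorems.Transplant.FKConnectivityAllQForestAdjacentTwoSum
import Summits.CriticalPhenomena.PercolationContinuityZ3.Theorems.Transplant.FKConnectivityAllQForestSeparatorExchange
import HarnessLib

/-!
# FAR TIGHT SETS DECOUPLE: a tight vertex set `U` not containing `e` or `f` factors out of every fibre count of the node

Support file (`--supports stmt-CriticalPhenomena-4575`), FK sub-lane `prim-bschramm-fk-1` (generation 29) of the post-continuity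
programme; builds on p205010 (kernel theorem, internal audit signed; external expert review pending).  No definitions, no named facts,
no sorries; standard axioms.  Companion of `…ForestTreeLevel*` (the tree level: the node ON a tight fibre).

SETTING.  Fibre `(M, u)` on the vertex type `V`; a finite vertex set `U`; `E₁ = {g | every vertex of g lies in U}` the pairs INSIDE `U`,
`E₂ = E₁ᶜ`.  `U` is TIGHT in the fibre when `2|U| ≤ |M ∩ E₁| + 2|u ∩ E₁| + 2`: then in every valid colouring both classes restricted to
`E₁` are spanning trees of `U` (`reachable_of_tight` of `…ForestTreeLevelTools` on the inside fibre `(M ∩ E₁, u ∩ E₁)`), so — by the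
separator-exchange theorem `isForestCfg_union_exchange` (fk-1 g20, `…ForestSeparatorExchange`: a configuration glued onto a forest sees only
the trace) — the outside classes may as well be glued onto ANY fixed spanning tree `T` of `U`.  Hence, for events `P, Q` that only look at
pairs outside `U`:
* **`fibreCount_eq_mul_of_farTight`**: `#_{(M,u)}(Fo ∩ P, Fo ∩ Q) = N_U · #_{(M ∩ E₂, u ∩ E₂)}({ω | T ∪ ω ∈ Fo ∩ P}, {ζ | T ∪ ζ ∈ Fo ∩ Q})` with
  `N_U = #_{(M ∩ E₁, u ∩ E₁)}(Fo, Fo)` the number of complementary spanning-tree pairs inside (via `fibreCount_eq_sum_twoSep`, g18);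
* **`fibreCount_union_pinned`**: pinning a set `T` of pairs disjoint from the fibre, `#_{(M', u' ∪ T)}(P, Q) = #_{(M', u')}({ω | ω ∪ T ∈ P}, {ζ | ζ ∪ T ∈ Q})`;
* **`adjForestNoSq_fibre_of_farTight`**: if `e = ov`, `f = oy` are NOT inside `U` (tight), the node's inequality on the CONTRACTED fibre
  `(M ∩ E₂, (u ∩ E₂) ∪ T)` (`U` replaced by the pinned spanning tree `T`: the kernel form of `G/U`) implies it on `(M, u)`.
This is the "far tight set" case (iii) of the minimal-counterexample reduction of memo bschramm/FROM-fk-1-g18-VERTEX-NC.md §4c, so far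
paper-level; with the tree level (`adjForestNoSq_fibre_of_tight`, case (i)) and the tight-set equality `adjForestNoSq_fibre_eq_of_tightSet`
(case (ii)) every tight set of a counterexample now reduces in the kernel.
[cite: CibulkaHladkyLaCroixWagner2008, Thm. 1 (p. 2)] [cite: SempleWelsh2008, Conj. 1.1 (p. 2)] [cite: Linusson2011, Prop. 2.6] [cite: Grimmett2006, §1.5 (p. 13)]
-/

noncomputable section

namespace Summit.CriticalPhenomena.PercolationContinuityZ3.Theorems
namespace FK

open MeasureTheory Set Literature.Probability.LatticeModels Literature.Probability.Percolation
open scoped Classical symmDiff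

variable {V : Type*} [Fintype V]

/-! ### Pinning a set of pairs -/

section Pinned

variable {M' u' T : BondConfig V}

omit [Fintype V] in
/-- Set algebra: `(ω ∪ T) ∖ M' = (ω ∖ M') ∪ T` when `T ∩ M' = ∅`. [folklore] -/
theorem union_sdiff_of_disjoint (hTM : Disjoint T M') (ω : BondConfig V) : (ω ∪ T) \ M' = (ω \ M') ∪ T := by
  ext x
  simp only [mem_sdiff, mem_union]
  constructor
  · rintro ⟨hx | hx, hxM⟩
    · exact Or.inl ⟨hx, hxM⟩
    · exact Or.inr hx
  · rintro (⟨hx, hxM⟩ | hx)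
    · exact ⟨Or.inl hx, hxM⟩
    · exact ⟨Or.inr hx, fun h => Set.disjoint_left.1 hTM hx h⟩

omit [Fintype V] in
/-- Set algebra: `(ω ∪ T) ∆ M' = (ω ∆ M') ∪ T` when `T ∩ M' = ∅`. [folklore] -/
theorem union_symmDiff_of_disjoint (hTM : Disjoint T M') (ω : BondConfig V) : (ω ∪ T) ∆ M' = (ω ∆ M') ∪ T := by
  ext x
  simp only [Set.mem_symmDiff, mem_union]
  have hx : x ∈ T → x ∉ M' := fun h h' => Set.disjoint_left.1 hTM h h'
  tauto

/-- **Pinning a set of pairs disjoint from the fibre**: `#_{(M', u' ∪ T)}(P, Q) = #_{(M', u')}({ω | ω ∪ T ∈ P}, {ζ | ζ ∪ T ∈ Q})`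
(`T` disjoint from `M'` and `u'`). [cite: Linusson2011, Prop. 2.6] -/
theorem fibreCount_union_pinned (hTM : Disjoint T M') (hTu : Disjoint T u') (P Q : Set (BondConfig V)) :
    fibreCount M' (u' ∪ T) P Q = fibreCount M' u' {ω | ω ∪ T ∈ P} {ζ | ζ ∪ T ∈ Q} := by
  symm
  refine fibreCount_eq_of_bij (fun ω => ω ∪ T) (fun ω => ω \ T) (fun ω hω hA hB => ?_) (fun ω hω hA hB => ?_)
  · have hωT : Disjoint ω T := by
      refine Set.disjoint_left.2 fun x hx hxT => ?_
      rcases (subset_union_of_fibre hω).1 hx with h | h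
      · exact Set.disjoint_left.1 hTM hxT h
      · exact Set.disjoint_left.1 hTu hxT h
    refine ⟨by rw [union_sdiff_of_disjoint hTM, hω], hA, ?_, ?_⟩
    · show (ω ∪ T) ∆ M' ∈ Q
      rw [union_symmDiff_of_disjoint hTM]; exact hB
    · show (ω ∪ T) \ T = ω
      rw [union_sdiff_right, sdiff_eq_left.2 hωT]
  · have hTω : T ⊆ ω := fun x hx => by
      have : x ∈ ω \ M' := by rw [hω]; exact Or.inr hx
      exact this.1
    have hback : ω \ T ∪ T = ω := by rw [sdiff_union_self, union_eq_left.2 hTω]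
    refine ⟨?_, ?_, ?_, hback⟩
    · show (ω \ T) \ M' = u'
      ext x
      simp only [mem_sdiff]
      constructor
      · rintro ⟨⟨hx, hxT⟩, hxM⟩
        have : x ∈ ω \ M' := ⟨hx, hxM⟩
        rw [hω] at this
        exact this.elim id fun h => absurd h hxT
      · intro hx
        have : x ∈ ω \ M' := by rw [hω]; exact Or.inl hx
        exact ⟨⟨this.1, fun h => Set.disjoint_left.1 hTu h hx⟩, this.2⟩
    · show ω \ T ∪ T ∈ P
      rw [hback]; exact hA
    · show (ω \ T) ∆ M' ∪ T ∈ Q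
      rw [← union_symmDiff_of_disjoint hTM, hback]; exact hB

end Pinned

/-! ### The decoupling -/

section FarTight

variable {M u T : BondConfig V} {U : Finset V} {P Q : Set (BondConfig V)}

/-- **Far tight sets decouple.**  Let `E₁` be the pairs inside the finite vertex set `U`, tight in the fibre `(M, u)`
(`2|U| ≤ |M ∩ E₁| + 2|u ∩ E₁| + 2`), let `T ⊆ E₁` be a forest joining `U` pairwise, and let `P, Q` be events blind to the pairs inside `U`.  Then
`#_{(M,u)}(Fo ∩ P, Fo ∩ Q) = #_{(M ∩ E₁, u ∩ E₁)}(Fo, Fo) · #_{(M ∖ E₁, u ∖ E₁)}({ω | ω ∪ T ∈ Fo ∩ P}, {ζ | ζ ∪ T ∈ Fo ∩ Q})`.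
[cite: CibulkaHladkyLaCroixWagner2008, Thm. 1 (p. 2)] [cite: Linusson2011, Prop. 2.6] [cite: Grimmett2006, §1.5 (p. 13)] -/
theorem fibreCount_eq_mul_of_farTight (ht : 2 * U.card ≤ (M ∩ {g : Sym2 V | ∀ w ∈ g, w ∈ U}).ncard + 2 * (u ∩ {g : Sym2 V | ∀ w ∈ g, w ∈ U}).ncard + 2)
    (hT : IsForestCfg T) (hTE : ∀ g ∈ T, ∀ w ∈ g, w ∈ U) (hTU : ∀ x ∈ U, ∀ y ∈ U, (openGraph T).Reachable x y)
    (hP : ∀ ω ω' : BondConfig V, ω \ {g : Sym2 V | ∀ w ∈ g, w ∈ U} = ω' \ {g : Sym2 V | ∀ w ∈ g, w ∈ U} → (ω ∈ P ↔ ω' ∈ P))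
    (hQ : ∀ ω ω' : BondConfig V, ω \ {g : Sym2 V | ∀ w ∈ g, w ∈ U} = ω' \ {g : Sym2 V | ∀ w ∈ g, w ∈ U} → (ω ∈ Q ↔ ω' ∈ Q)) :
    fibreCount M u (forestEv V ∩ P) (forestEv V ∩ Q) =
      fibreCount (M ∩ {g : Sym2 V | ∀ w ∈ g, w ∈ U}) (u ∩ {g : Sym2 V | ∀ w ∈ g, w ∈ U}) (forestEv V) (forestEv V) *
        fibreCount (M \ {g : Sym2 V | ∀ w ∈ g, w ∈ U}) (u \ {g : Sym2 V | ∀ w ∈ g, w ∈ U})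
          {ω | ω ∪ T ∈ forestEv V ∩ P} {ζ | ζ ∪ T ∈ forestEv V ∩ Q} := by
  set E₁ : Set (Sym2 V) := {g : Sym2 V | ∀ w ∈ g, w ∈ U} with hE₁
  have hd : Disjoint E₁ E₁ᶜ := disjoint_compl_right
  have hMu : M ∪ u ⊆ E₁ ∪ E₁ᶜ := by rw [union_compl_self]; exact subset_univ _
  have hM2 : M \ E₁ = M ∩ E₁ᶜ := sdiff_eq _ _
  have hu2 : u \ E₁ = u ∩ E₁ᶜ := sdiff_eq _ _
  rw [fibreCount_eq_sum_twoSep hd hMu, hM2, hu2]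
  -- inside pairs lie inside `U`; the inside fibre is tight on `U`
  have hS1 : ∀ g ∈ M ∩ E₁ ∪ u ∩ E₁, ∀ w ∈ g, w ∈ U := fun g hg w hw => by
    rcases hg with hg | hg
    · exact hg.2 w hw
    · exact hg.2 w hw
  have hTE₁ : T ⊆ E₁ := fun g hg w hw => hTE g hg w hw
  -- the inner count: `C` on valid inside configurations, `0` otherwise
  set C := fibreCount (M ∩ E₁ᶜ) (u ∩ E₁ᶜ) {ω | ω ∪ T ∈ forestEv V ∩ P} {ζ | ζ ∪ T ∈ forestEv V ∩ Q} with hC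
  have inner : ∀ ω₁ : BondConfig V, ω₁ \ (M ∩ E₁) = u ∩ E₁ →
      fibreCount (M ∩ E₁ᶜ) (u ∩ E₁ᶜ) {ω₂ | ω₁ ∪ ω₂ ∈ forestEv V ∩ P} {ζ | (ω₁ ∆ (M ∩ E₁)) ∪ ζ ∈ forestEv V ∩ Q} =
        if IsForestCfg ω₁ ∧ IsForestCfg (ω₁ ∆ (M ∩ E₁)) then C else 0 := by
    intro ω₁ hω₁
    have hω₁E : ω₁ ⊆ E₁ := fun x hx => ((subset_union_of_fibre hω₁).1 hx).elim (fun h => h.2) (fun h => h.2)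
    have hω₁'E : ω₁ ∆ (M ∩ E₁) ⊆ E₁ := fun x hx => ((subset_union_of_fibre hω₁).2 hx).elim (fun h => h.2) (fun h => h.2)
    split_ifs with hval
    · -- valid inside pair: both classes are spanning trees of `U`; exchange them for `T`
      obtain ⟨hF₁, hF₁'⟩ := hval
      have hR₁ : ∀ x ∈ (↑U : Set V), ∀ y ∈ (↑U : Set V), (openGraph ω₁).Reachable x y ↔ (openGraph T).Reachable x y :=
        fun x hx y hy => ⟨fun _ => hTU x hx y hy, fun _ => reachable_of_tight hS1 ht hω₁ hF₁ hF₁' hx hy⟩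
      have hR₁' : ∀ x ∈ (↑U : Set V), ∀ y ∈ (↑U : Set V), (openGraph (ω₁ ∆ (M ∩ E₁))).Reachable x y ↔ (openGraph T).Reachable x y :=
        fun x hx y hy => ⟨fun _ => hTU x hx y hy, fun _ => reachable_symmDiff_of_tight hS1 ht hω₁ hF₁ hF₁' hx hy⟩
      rw [hC]
      refine fibreCount_congr_fibre _ _ fun ω₂ hω₂ => ?_
      have hω₂E : ω₂ ⊆ E₁ᶜ := fun x hx => ((subset_union_of_fibre hω₂).1 hx).elim (fun h => h.2) (fun h => h.2)
      have hζE : ω₂ ∆ (M ∩ E₁ᶜ) ⊆ E₁ᶜ := fun x hx => ((subset_union_of_fibre hω₂).2 hx).elim (fun h => h.2) (fun h => h.2)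
      -- exchange lemma, both directions, for the configuration and for its partner
      have ex : ∀ {Z : BondConfig V} {ξ : BondConfig V}, Z ⊆ E₁ → ξ ⊆ E₁ᶜ → IsForestCfg Z →
          (∀ x ∈ (↑U : Set V), ∀ y ∈ (↑U : Set V), (openGraph Z).Reachable x y ↔ (openGraph T).Reachable x y) →
          (IsForestCfg (Z ∪ ξ) ↔ IsForestCfg (ξ ∪ T)) := by
        intro Z ξ hZ hξ hZF hR
        have hZW : ∀ g ∈ Z, ∀ x ∈ g, x ∈ (univ : Set V) → x ∈ (↑U : Set V) := fun g hg x hx _ => hZ hg x hx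
        have hTW : ∀ g ∈ T, ∀ x ∈ g, x ∈ (univ : Set V) → x ∈ (↑U : Set V) := fun g hg x hx _ => hTE g hg x hx
        have hξX : ∀ g ∈ ξ, ∀ x ∈ g, x ∈ (univ : Set V) := fun _ _ _ _ => mem_univ _
        have hdZ : Disjoint ξ Z := Set.disjoint_left.2 fun x hx hx' => hξ hx (hZ hx')
        have hdT : Disjoint ξ T := Set.disjoint_left.2 fun x hx hx' => hξ hx (hTE₁ hx')
        constructor
        · intro h
          rw [union_comm] at h
          exact isForestCfg_union_exchange hξX hZW hTW hR hdZ hdT h hT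
        · intro h
          have h' := isForestCfg_union_exchange hξX hTW hZW (fun x hx y hy => (hR x hx y hy).symm) hdT hdZ h hZF
          rwa [union_comm] at h'
      have e1 : IsForestCfg (ω₁ ∪ ω₂) ↔ IsForestCfg (ω₂ ∪ T) := ex hω₁E hω₂E hF₁ hR₁
      have e2 : IsForestCfg ((ω₁ ∆ (M ∩ E₁)) ∪ (ω₂ ∆ (M ∩ E₁ᶜ))) ↔ IsForestCfg ((ω₂ ∆ (M ∩ E₁ᶜ)) ∪ T) := ex hω₁'E hζE hF₁' hR₁'
      -- blindness of `P, Q`: the outside parts agree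
      have p1 : (ω₁ ∪ ω₂) \ E₁ = (ω₂ ∪ T) \ E₁ := by
        rw [union_sdiff_distrib, union_sdiff_distrib, sdiff_eq_empty.2 hω₁E, sdiff_eq_empty.2 hTE₁, empty_union, union_empty]
      have p2 : ((ω₁ ∆ (M ∩ E₁)) ∪ (ω₂ ∆ (M ∩ E₁ᶜ))) \ E₁ = ((ω₂ ∆ (M ∩ E₁ᶜ)) ∪ T) \ E₁ := by
        rw [union_sdiff_distrib, union_sdiff_distrib, sdiff_eq_empty.2 hω₁'E, sdiff_eq_empty.2 hTE₁, empty_union, union_empty]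
      simp only [mem_setOf_eq, mem_inter_iff, forestEv, e1, e2, hP _ _ p1, hQ _ _ p2]
    · -- invalid inside pair: no outside completion
      refine fibreCount_eq_zero_of_forall _ _ _ _ fun ω₂ hω₂ hA hB => hval ⟨?_, ?_⟩
      · exact isForestCfg_of_subset hA.1 subset_union_left
      · exact isForestCfg_of_subset hB.1 subset_union_left
  rw [Finset.sum_congr rfl fun ω₁ hω₁ => inner ω₁ (Finset.mem_filter.1 hω₁).2, Finset.sum_ite, Finset.sum_const_zero, add_zero,
    Finset.sum_const, smul_eq_mul, Finset.filter_filter]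
  rfl

/-- **The node across a far tight set.**  With `E₁` the pairs inside the tight set `U` (`2|U| ≤ |M ∩ E₁| + 2|u ∩ E₁| + 2`), `T ⊆ E₁` a forest
joining `U` pairwise, and `e = ov`, `f = oy` NOT inside `U`: the node's inequality on the contracted fibre `(M ∖ E₁, (u ∖ E₁) ∪ T)` implies
the node's inequality on `(M, u)`. [cite: SempleWelsh2008, Conj. 1.1 (p. 2)] [cite: CibulkaHladkyLaCroixWagner2008, Thm. 1 (p. 2)] [cite: Linusson2011, Prop. 2.6] -/
theorem adjForestNoSq_fibre_of_farTight {o v y : V}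
    (ht : 2 * U.card ≤ (M ∩ {g : Sym2 V | ∀ w ∈ g, w ∈ U}).ncard + 2 * (u ∩ {g : Sym2 V | ∀ w ∈ g, w ∈ U}).ncard + 2)
    (hT : IsForestCfg T) (hTE : ∀ g ∈ T, ∀ w ∈ g, w ∈ U) (hTU : ∀ x ∈ U, ∀ y ∈ U, (openGraph T).Reachable x y)
    (he : s(o, v) ∉ {g : Sym2 V | ∀ w ∈ g, w ∈ U}) (hf : s(o, y) ∉ {g : Sym2 V | ∀ w ∈ g, w ∈ U})
    (hnode : fibreCount (M \ {g : Sym2 V | ∀ w ∈ g, w ∈ U}) (u \ {g : Sym2 V | ∀ w ∈ g, w ∈ U} ∪ T)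
        (forestEv V ∩ {ω | s(o, v) ∈ ω ∧ s(o, y) ∈ ω}) (forestEv V) ≤
      fibreCount (M \ {g : Sym2 V | ∀ w ∈ g, w ∈ U}) (u \ {g : Sym2 V | ∀ w ∈ g, w ∈ U} ∪ T)
        (forestEv V ∩ {ω | s(o, v) ∈ ω}) (forestEv V ∩ {ω | s(o, y) ∈ ω})) :
    fibreCount M u (forestEv V ∩ {ω | s(o, v) ∈ ω ∧ s(o, y) ∈ ω}) (forestEv V) ≤
      fibreCount M u (forestEv V ∩ {ω | s(o, v) ∈ ω}) (forestEv V ∩ {ω | s(o, y) ∈ ω}) := by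
  set E₁ : Set (Sym2 V) := {g : Sym2 V | ∀ w ∈ g, w ∈ U} with hE₁
  have hTM : Disjoint T (M \ E₁) := Set.disjoint_left.2 fun x hx h => h.2 (fun w hw => hTE x hx w hw)
  have hTu : Disjoint T (u \ E₁) := Set.disjoint_left.2 fun x hx h => h.2 (fun w hw => hTE x hx w hw)
  -- blindness of the node's events
  have blind : ∀ (g : Sym2 V), g ∉ E₁ → ∀ ω ω' : BondConfig V, ω \ E₁ = ω' \ E₁ → (g ∈ ω ↔ g ∈ ω') := fun g hg ω ω' h =>
    ⟨fun h' => by have : g ∈ ω \ E₁ := ⟨h', hg⟩; rw [h] at this; exact this.1,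
      fun h' => by have : g ∈ ω' \ E₁ := ⟨h', hg⟩; rw [← h] at this; exact this.1⟩
  have hPb : ∀ ω ω' : BondConfig V, ω \ E₁ = ω' \ E₁ →
      (ω ∈ {ω : BondConfig V | s(o, v) ∈ ω ∧ s(o, y) ∈ ω} ↔ ω' ∈ {ω : BondConfig V | s(o, v) ∈ ω ∧ s(o, y) ∈ ω}) := fun ω ω' h => by
    simp only [mem_setOf_eq, blind _ he ω ω' h, blind _ hf ω ω' h]
  have hPe : ∀ ω ω' : BondConfig V, ω \ E₁ = ω' \ E₁ → (ω ∈ {ω : BondConfig V | s(o, v) ∈ ω} ↔ ω' ∈ {ω : BondConfig V | s(o, v) ∈ ω}) :=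
    fun ω ω' h => by simp only [mem_setOf_eq, blind _ he ω ω' h]
  have hPf : ∀ ω ω' : BondConfig V, ω \ E₁ = ω' \ E₁ → (ω ∈ {ω : BondConfig V | s(o, y) ∈ ω} ↔ ω' ∈ {ω : BondConfig V | s(o, y) ∈ ω}) :=
    fun ω ω' h => by simp only [mem_setOf_eq, blind _ hf ω ω' h]
  have hU : ∀ ω ω' : BondConfig V, ω \ E₁ = ω' \ E₁ → (ω ∈ (univ : Set (BondConfig V)) ↔ ω' ∈ (univ : Set (BondConfig V))) :=
    fun _ _ _ => by simp
  have hb0 : fibreCount M u (forestEv V ∩ {ω | s(o, v) ∈ ω ∧ s(o, y) ∈ ω}) (forestEv V) =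
      fibreCount M u (forestEv V ∩ {ω | s(o, v) ∈ ω ∧ s(o, y) ∈ ω}) (forestEv V ∩ univ) := by rw [inter_univ]
  rw [hb0, fibreCount_eq_mul_of_farTight ht hT hTE hTU hPb hU, fibreCount_eq_mul_of_farTight ht hT hTE hTU hPe hPf]
  refine Nat.mul_le_mul_left _ ?_
  rw [fibreCount_union_pinned hTM hTu, fibreCount_union_pinned hTM hTu] at hnode
  rw [inter_univ]
  exact hnode

end FarTight

end FK
end Summit.CriticalPhenomena.PercolationContinuityZ3.Theorems

end
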